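import Mathlib
import HarnessLib
import Summits.QuantumFields.YangMills.Theses.ConvexGribovBody
import Summits.QuantumFields.YangMills.Theses.SmallCircleAnchor
import Summits.QuantumFields.YangMills.Theses.HyperbolicRegulator
import Summits.QuantumFields.YangMills.Theses.ContractibleFibre
import Summits.QuantumFields.YangMills.Theses.ComplexCouplingChannel
import Summits.QuantumFields.YangMills.Theses.DoublingDefect
import Summits.QuantumFields.YangMills.Theses.NoiseSynchronisation
import Summits.QuantumFields.YangMills.Theses.DirichletWindow
import Summits.QuantumFields.YangMills.Theorems.ComplexCouplingChannelContinuumLegGivenGapSplit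
import Summits.QuantumFields.YangMills.Theorems.ParabolicTrajectoryContinuumLimitOnTrajectoryDefsC
import Summits.QuantumFields.YangMills.Theorems.ComplexCouplingChannelContinuumLegGivenGapAlternatingArraysDefs
import Summits.QuantumFields.YangMills.Theorems.ComplexCouplingChannelContinuumLegGivenGapStubAbstractChessboard
import Summits.QuantumFields.YangMills.Theorems.ComplexCouplingChannelContinuumLegGivenGapStubArrayFunctional
import Literature.Probability.LatticeModels.ChessboardEstimateEvenTorus
import Literature.Probability.LatticeModels.ChessboardEstimateAssignments
import Summits.QuantumFields.YangMills.Theorems.ComplexCouplingChannelContinuumLegGivenGapArraysChessboard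

/-!
# Line `alternating-curvature-arrays`: the crux `ContinuumLegGivenGap` (stmt-QuantumFields-15828) REDUCED to the array
exponent bound (CB) and the two sockets — all chessboard / reflection-positivity / grid machinery proved

Def-free reduction theorem of the line (the analogue of the dead line `Sketch`'s `ContinuumLegGivenGap_of_subs_all`, through
which it goes): `ContinuumLegGivenGap_of_arrays : XiDiverges → ⟨FR⟩ → ⟨CB⟩ → ⟨PTU⟩ → ⟨SW⟩ → ComplexCouplingChannel.ContinuumLegGivenGap`
(+ six by-name twins), where the four hypotheses are VERBATIM the registered open stubs of the line's skeleton
(`Cruxes/ContinuumLegGivenGap/Lines/alternating_curvature_arrays.lean`): (FR) `stub_floorAndRotation` = child 2 minus (UUVB),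
tail-shaped ((ND) two-point floor ∧ (ROT₃₄₅); open, child-2 class); (CB) `stub_arrayExponent` = ONE k-uniform bound on the
one-body array exponent `arrayRoot` per scale (THE BET of the line; open, UV content); (PTU) `stub_productToUniform` =
`PolyVolumeGrowth → ProductBound → UUVB` (the Whitney / grid-shift / nuclear step; provable lattice analysis, helpers landed);
(SW) `stub_skewWindow` = child 3 verbatim (NLO skewness window; open).  PROVED here: (CHESS) ∧ (CB) ⇒ (PB)
(`arrays_productBound_of_exponent`, with the landed `arrays_chessboard`), child 2 re-assembled on the triadic tail family
`𝓛 k = {L ≥ Λ k, 2L+1 = 3^M}` (`arrays_uvEngine`), and the compositions.  No definitions, no sorry; axioms standard. [folklore]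
-/

set_option autoImplicit false

noncomputable section

namespace Summit.QuantumFields.YangMills.Theorems.ContinuumLegGivenGap

open scoped SchwartzMap
open Filter Topology MeasureTheory
open Literature.MathematicalPhysics.QuantumFieldTheory Literature.MathematicalPhysics.QuantumLattice
  Literature.MathematicalPhysics.AQFT Literature.Probability.LatticeModels
open Summit.QuantumFields.YangMills.Theses
open Summit.QuantumFields.YangMills.Cruxes.ContinuumLimitOnTrajectory.TwoOrbitSynchronisation
  (PlaqIdx plaq canonDistribution UUVB PolyVolumeGrowth)
open Summit.QuantumFields.YangMills.Theorems.ContinuumLegGivenGap.AlternatingArrays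

section Reduction

variable {G : Type} [Group G] [TopologicalSpace G] [IsTopologicalGroup G] [CompactSpace G]
  [MeasurableSpace G] [BorelSpace G]

/-- Triadic torus half-sides are cofinal: `n ≤ (3^M - 1)/2` for some `M`. [folklore] -/
theorem arrays_exists_triadic_ge : ∀ (n : ℕ), ∃ L : ℕ, n ≤ L ∧ IsTriadic L := by
  intro n
  obtain ⟨M, hM⟩ := pow_unbounded_of_one_lt (2 * n + 1) (by norm_num : (1 : ℕ) < 3)
  -- `3^M` is odd, so `3^M = 2L+1` with `L = (3^M - 1)/2 ≥ n`
  obtain ⟨L, hL⟩ : Odd (3 ^ M) := Odd.pow (by decide : Odd 3)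
  exact ⟨L, by omega, M, by omega⟩

/-- The array exponent is non-negative once the array expectation is. [folklore] -/
theorem arrays_arrayRoot_nonneg (r : LatticeRep G) (βv a : ℝ) (L m : ℕ) (v z₀ : Fin 4 → ℤ) (q : PlaqIdx)
    (f : 𝓢((EuclideanSpace ℝ (Fin 4)), ℝ)) (h : 0 ≤ arrayMean r βv a L m v z₀ q f) : 0 ≤ arrayRoot r βv a L m v z₀ q f :=
  Real.rpow_nonneg h _

/-- **(CHESS) ∧ (CB) ⇒ (PB)** along a scheme pinned to the engine data: the product of array exponents is bounded
factor by factor. [folklore] -/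
theorem arrays_productBound_of_exponent (r : LatticeRep G) (sch : SpeciesScheme (YMSpecies G))
    {β : ℕ → ℝ} {φ : ℕ → ℕ} {a : ℕ → ℝ} {Λ : ℕ → ℕ} {C : ℝ} {p s k₀ : ℕ}
    (hsa : ∀ k, sch.a k = a k) (hsβ : ∀ k, sch.β k = β (φ k)) (hsL : ∀ k, Λ k ≤ sch.L k ∧ IsTriadic (sch.L k))
    (hβ : Tendsto β atTop atTop) (hφ : StrictMono φ) (hC : 0 ≤ C)
    (hCBk : ∀ k : ℕ, k₀ ≤ k → ∀ L : ℕ, Λ k ≤ L → IsTriadic L →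
      ∀ (m : ℕ) (v z₀ : Fin 4 → ℤ) (q : PlaqIdx) (f : 𝓢((EuclideanSpace ℝ (Fin 4)), ℝ)),
        LevelAdmissible L m → CellInHalfBox L m v z₀ → tsupport f ⊆ physCore (a k) m v z₀ →
        arrayRoot r (β (φ k)) (a k) L m v z₀ q f ≤
          C * max (a k * cellSide m) (a k * cellSide m)⁻¹ ^ p * cellNorm s (a k * cellSide m) f) :
    ProductBound r sch := by
  -- the couplings of the scheme are eventually non-negative
  have hβ' : Tendsto (fun k => sch.β k) atTop atTop := by
    rw [show (fun k => sch.β k) = β ∘ φ from funext hsβ]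
    exact hβ.comp hφ.tendsto_atTop
  obtain ⟨k₁, hk₁⟩ := (tendsto_atTop.1 hβ' 0).exists_forall_of_atTop
  refine ⟨C, p, s, max k₀ k₁, hC, fun k hk => ⟨(hsL k).2, ?_⟩⟩
  intro n m v q z f F hm hbox hz hf hF
  have hk₀ : k₀ ≤ k := (le_max_left _ _).trans hk
  have hβk : 0 ≤ sch.β k := hk₁ k ((le_max_right _ _).trans hk)
  obtain ⟨hnn, hle⟩ := arrays_chessboard G r sch k m hβk hm v n q z f F hbox hz hf hF
  refine hle.trans (Finset.prod_le_prod (fun i _ => arrays_arrayRoot_nonneg r _ _ _ _ _ _ _ _ (hnn i)) fun i _ => ?_)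
  have h := hCBk k hk₀ (sch.L k) (hsL k).1 (hsL k).2 m v (z i) (q i) (f i) hm (hbox i) (by rw [← hsa]; exact hf i)
  simpa only [hsa, hsβ] using h

/-! ### The four open statements of the line as def-free hypotheses (registered stubs, VERBATIM) -/

variable
  (hFR : ∀ (G : Type) [Group G] [TopologicalSpace G] [IsTopologicalGroup G] [CompactSpace G]
        [MeasurableSpace G] [BorelSpace G], IsCompactSimpleLieGroup G → ∃ r : LatticeRep G,
        ∀ (β : ℕ → ℝ) (mh : ℕ → ℝ) (S₁ : ℕ → ℕ) (K : ℝ), Tendsto β atTop atTop → (∀ k, 0 < mh k) → 0 < K →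
        (∀ A B : YMSpecies G, ∃ C : ℝ, ∀ k S n : ℕ, S₁ k ≤ S → n ≤ S →
          |latticeConnectedCorr r.ρ (β k) (2 * S + 1) A.F B.F n| ≤ C * Real.exp (-(mh k * n))) →
        (∀ k S₀ : ℕ, ∃ A B : YMSpecies G, ∀ C : ℝ, ∃ S n : ℕ, S₀ ≤ S ∧ n ≤ S ∧
          C * Real.exp (-(K * mh k * n)) < |latticeConnectedCorr r.ρ (β k) (2 * S + 1) A.F B.F n|) →
        Tendsto mh atTop (𝓝 0) →
        ∃ (a : ℕ → ℝ) (φ : ℕ → ℕ) (Δ₀ : ℝ) (Λ₀ : ℕ → ℕ),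
          (∀ k, 0 < a k) ∧ StrictMono φ ∧ 0 < Δ₀ ∧ (∀ k, Δ₀ * a k ≤ mh (φ k)) ∧ (∀ k, S₁ (φ k) ≤ Λ₀ k) ∧
          (∃ N : ℕ, 1 ≤ N ∧ ∀ᶠ k in atTop, ∀ S : ℕ, Λ₀ k ≤ S → (a k)⁻¹ ≤ (a k * (S : ℝ)) ^ N) ∧
        ∀ (sch : SpeciesScheme (YMSpecies G)), (∀ k, sch.a k = a k) → (∀ k, sch.β k = β (φ k)) →
          (∀ k, Λ₀ k ≤ sch.L k) →
        ∀ (LS : (k n : ℕ) → SchwartzMap (Fin n → EuclideanSpace ℝ (Fin 4)) ℂ → ℂ),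
        (∀ (k n : ℕ) (F : SchwartzMap (Fin n → EuclideanSpace ℝ (Fin 4)) ℂ), LS k n F =
          ∫ U : GaugeConfig 4 (sch.side k) G, ∑ x : Fin n → ↥(Literature.Probability.LatticeModels.box 4 (sch.L k)),
            F (fun i => sch.a k • siteToE ↑(x i)) *
              ∏ i, ((sch.c r.curvature k * sch.a k ^ 4 *
                (r.curvature.F (Literature.MathematicalPhysics.QuantumLattice.configShift (-↑(x i)) (Literature.MathematicalPhysics.QuantumLattice.torusLift (sch.side k) U)) - sch.m r.curvature k) : ℝ) : ℂ)
            ∂(wilsonMeasure r.ρ (sch.β k))) →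
        (∀ k : ℕ, sch.m r.curvature k =
          ∫ U : GaugeConfig 4 (sch.side k) G, r.curvature.F (Literature.MathematicalPhysics.QuantumLattice.torusLift (sch.side k) U) ∂(wilsonMeasure r.ρ (sch.β k))) →
        (∀ k : ℕ, sch.c r.curvature k = (sch.a k ^ 4)⁻¹) →
        (∃ (f g : SchwartzMap (Fin 1 → EuclideanSpace ℝ (Fin 4)) ℂ)
          (H : SchwartzMap (Fin (1 + 1) → EuclideanSpace ℝ (Fin 4)) ℂ),
          IsTimeOrdered f ∧ IsTimeOrdered g ∧ IsAppendTensorOf H (osAdjoint f) g ∧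
            ∃ δ : ℝ, 0 < δ ∧ ∀ᶠ k in atTop, δ ≤ ‖LS k (1 + 1) H‖) ∧
        (∀ R : EuclideanSpace ℝ (Fin 4) ≃ₗᵢ[ℝ] EuclideanSpace ℝ (Fin 4),
          R (EuclideanSpace.single 0 1) =
            (3 / 5 : ℝ) • EuclideanSpace.single 0 1 + (-(4 / 5) : ℝ) • EuclideanSpace.single 1 1 →
          R (EuclideanSpace.single 1 1) =
            (4 / 5 : ℝ) • EuclideanSpace.single 0 1 + (3 / 5 : ℝ) • EuclideanSpace.single 1 1 →
          R (EuclideanSpace.single 2 1) = EuclideanSpace.single 2 1 →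
          R (EuclideanSpace.single 3 1) = EuclideanSpace.single 3 1 →
          ∀ (n : ℕ) (F : SchwartzMap (Fin n → EuclideanSpace ℝ (Fin 4)) ℂ), IsOffDiagonal F →
            Tendsto (fun k : ℕ => LS k n (linActMulti R F) - LS k n F) atTop (𝓝 0)))
  (hCB : ∀ (G : Type) [Group G] [TopologicalSpace G] [IsTopologicalGroup G] [CompactSpace G]
        [MeasurableSpace G] [BorelSpace G], IsCompactSimpleLieGroup G →
        ∀ (r : LatticeRep G) (β : ℕ → ℝ) (mh : ℕ → ℝ) (S₁ : ℕ → ℕ),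
        Tendsto β atTop atTop → (∀ k, 0 < mh k) →
        (∀ A B : YMSpecies G, ∃ C : ℝ, ∀ k S n : ℕ, S₁ k ≤ S → n ≤ S →
          |latticeConnectedCorr r.ρ (β k) (2 * S + 1) A.F B.F n| ≤ C * Real.exp (-(mh k * n))) →
        ∀ (a : ℕ → ℝ) (φ : ℕ → ℕ) (Δ₀ : ℝ) (Λ₀ : ℕ → ℕ),
          (∀ k, 0 < a k) → StrictMono φ → 0 < Δ₀ → (∀ k, Δ₀ * a k ≤ mh (φ k)) → (∀ k, S₁ (φ k) ≤ Λ₀ k) →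
          ∃ (Λ : ℕ → ℕ) (C : ℝ) (p s k₀ : ℕ), (∀ k, Λ₀ k ≤ Λ k) ∧ 0 ≤ C ∧
            ∀ k : ℕ, k₀ ≤ k → ∀ L : ℕ, Λ k ≤ L → IsTriadic L →
            ∀ (m : ℕ) (v z₀ : Fin 4 → ℤ) (q : PlaqIdx) (f : 𝓢((EuclideanSpace ℝ (Fin 4)), ℝ)),
              LevelAdmissible L m → CellInHalfBox L m v z₀ → tsupport f ⊆ physCore (a k) m v z₀ →
              arrayRoot r (β (φ k)) (a k) L m v z₀ q f ≤
                C * max (a k * cellSide m) (a k * cellSide m)⁻¹ ^ p * cellNorm s (a k * cellSide m) f)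
  (hPTU : ∀ (G : Type) [Group G] [TopologicalSpace G] [IsTopologicalGroup G] [CompactSpace G]
        [MeasurableSpace G] [BorelSpace G] (r : LatticeRep G) (sch : SpeciesScheme (YMSpecies G)),
        PolyVolumeGrowth sch → ProductBound r sch → UUVB r sch)
  (hSW : ∀ (G : Type) [Group G] [TopologicalSpace G] [IsTopologicalGroup G] [CompactSpace G]
        [MeasurableSpace G] [BorelSpace G], IsCompactSimpleLieGroup G →
        ∀ (r : LatticeRep G) (sch : SpeciesScheme (YMSpecies G))
          (LS : (k n : ℕ) → SchwartzMap (Fin n → EuclideanSpace ℝ (Fin 4)) ℂ → ℂ),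
        (∀ (k n : ℕ) (F : SchwartzMap (Fin n → EuclideanSpace ℝ (Fin 4)) ℂ), LS k n F =
          ∫ U : GaugeConfig 4 (sch.side k) G, ∑ x : Fin n → ↥(box 4 (sch.L k)),
            F (fun i => sch.a k • siteToE ↑(x i)) *
              ∏ i, ((sch.c r.curvature k * sch.a k ^ 4 *
                (r.curvature.F (configShift (-↑(x i)) (torusLift (sch.side k) U)) - sch.m r.curvature k) : ℝ) : ℂ)
            ∂(wilsonMeasure r.ρ (sch.β k))) →
        Tendsto sch.β atTop atTop →
        (∀ k : ℕ, sch.m r.curvature k =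
          ∫ U : GaugeConfig 4 (sch.side k) G, r.curvature.F (torusLift (sch.side k) U) ∂(wilsonMeasure r.ρ (sch.β k))) →
        (∃ (s : ℕ) (α β' : ℝ), ∀ (n : ℕ) (F : SchwartzMap (Fin n → EuclideanSpace ℝ (Fin 4)) ℂ),
          IsOffDiagonal F → ∀ᶠ k in atTop, ‖LS k n F‖ ≤ α * (n.factorial : ℝ) ^ β' * schwartzNorm (n * s) F) →
        (∃ (f g : SchwartzMap (Fin 1 → EuclideanSpace ℝ (Fin 4)) ℂ)
          (H : SchwartzMap (Fin (1 + 1) → EuclideanSpace ℝ (Fin 4)) ℂ),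
          IsTimeOrdered f ∧ IsTimeOrdered g ∧ IsAppendTensorOf H (osAdjoint f) g ∧
            ∃ δ : ℝ, 0 < δ ∧ ∀ᶠ k in atTop, δ ≤ ‖LS k (1 + 1) H‖) →
        (∃ Δ : ℝ, 0 < Δ ∧ ∀ (n m : ℕ) (F : SchwartzMap (Fin n → EuclideanSpace ℝ (Fin 4)) ℂ)
          (G' : SchwartzMap (Fin m → EuclideanSpace ℝ (Fin 4)) ℂ), IsTimeOrdered F → IsTimeOrdered G' →
          ∃ C : ℝ, ∀ t : ℝ, 0 ≤ t → ∀ᶠ k in atTop,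
            ∀ H : SchwartzMap (Fin (n + m) → EuclideanSpace ℝ (Fin 4)) ℂ,
              IsAppendTensorOf H (osAdjoint F) (translateMulti (EuclideanSpace.single 0 t) G') →
                ‖LS k (n + m) H - LS k n (osAdjoint F) * LS k m G'‖ ≤ C * Real.exp (-Δ * t)) →
        ∃ (s₃ : ℂ) (φ : ℕ → ℕ) (f g h : ℕ → SchwartzMap (EuclideanSpace ℝ (Fin 4)) ℂ)
          (F₃ : ℕ → SchwartzMap (Fin 3 → EuclideanSpace ℝ (Fin 4)) ℂ) (w : ℕ → ℝ),
          s₃ ≠ 0 ∧ StrictMono φ ∧ (∀ j, 0 < w j) ∧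
            (∀ j, IsTensorOf (F₃ j) ![f j, g j, h j] ∧ IsOffDiagonal (F₃ j)) ∧
            ∀ ε : ℝ, 0 < ε → ∀ᶠ j in atTop, ∀ᶠ k in atTop, ‖LS (φ k) 3 (F₃ j) / (w j : ℂ) - s₃‖ ≤ ε)

include hFR hCB hPTU in
/-- **Child 2 (the volume-uniform UV engine `stub_uvPackageVol`, verbatim the second hypothesis of the landed
`ContinuumLegGivenGap_of_subs_all`) FROM the line's three open statements** — the IR/symmetry socket (FR) =
`stub_floorAndRotation` (child 2 minus (UUVB), tail-shaped), the array exponent bound (CB) = `stub_arrayExponent` (the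
line's bet) and the Whitney step (PTU) = `stub_productToUniform` ((PB) ⇒ (UUVB)) — all three taken as def-free
HYPOTHESES (registered stubs of stmt-QuantumFields-15828, open): the socket supplies `r`, the engine data and (ND) ∧ (ROT);
(CB) supplies a volume threshold `Λ`; the admissible torus family is `𝓛 k = {L ≥ Λ k, 2L+1 = 3^M}` (cofinal, inside the
clustering regime, of polynomial growth); on it (UUVB) follows from the PROVED chessboard estimate `arrays_chessboard`, (CB)
and (PTU). [folklore] -/
theorem arrays_uvEngine :
    ∀ (G : Type) [Group G] [TopologicalSpace G] [IsTopologicalGroup G] [CompactSpace G]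
      [MeasurableSpace G] [BorelSpace G], IsCompactSimpleLieGroup G → ∃ r : LatticeRep G,
      ∀ (β : ℕ → ℝ) (mh : ℕ → ℝ) (S₁ : ℕ → ℕ) (K : ℝ), Tendsto β atTop atTop → (∀ k, 0 < mh k) → 0 < K →
      (∀ A B : YMSpecies G, ∃ C : ℝ, ∀ k S n : ℕ, S₁ k ≤ S → n ≤ S →
        |latticeConnectedCorr r.ρ (β k) (2 * S + 1) A.F B.F n| ≤ C * Real.exp (-(mh k * n))) →
      (∀ k S₀ : ℕ, ∃ A B : YMSpecies G, ∀ C : ℝ, ∃ S n : ℕ, S₀ ≤ S ∧ n ≤ S ∧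
        C * Real.exp (-(K * mh k * n)) < |latticeConnectedCorr r.ρ (β k) (2 * S + 1) A.F B.F n|) →
      Tendsto mh atTop (𝓝 0) →
      ∃ (a : ℕ → ℝ) (φ : ℕ → ℕ) (Δ₀ : ℝ) (𝓛 : ℕ → Set ℕ),
        (∀ k, 0 < a k) ∧ StrictMono φ ∧ 0 < Δ₀ ∧ (∀ k, Δ₀ * a k ≤ mh (φ k)) ∧
        (∀ k S : ℕ, ∃ S' : ℕ, S' ∈ 𝓛 k ∧ S ≤ S') ∧ (∀ k : ℕ, ∀ S ∈ 𝓛 k, S₁ (φ k) ≤ S) ∧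
        (∃ N : ℕ, 1 ≤ N ∧ ∀ᶠ k in atTop, ∀ S ∈ 𝓛 k, (a k)⁻¹ ≤ (a k * (S : ℝ)) ^ N) ∧
      ∀ (sch : SpeciesScheme (YMSpecies G)), (∀ k, sch.a k = a k) → (∀ k, sch.β k = β (φ k)) →
        (∀ k, sch.L k ∈ 𝓛 k) →
      ∀ (LS : (k n : ℕ) → SchwartzMap (Fin n → EuclideanSpace ℝ (Fin 4)) ℂ → ℂ),
      (∀ (k n : ℕ) (F : SchwartzMap (Fin n → EuclideanSpace ℝ (Fin 4)) ℂ), LS k n F =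
        ∫ U : GaugeConfig 4 (sch.side k) G, ∑ x : Fin n → ↥(Literature.Probability.LatticeModels.box 4 (sch.L k)),
          F (fun i => sch.a k • siteToE ↑(x i)) *
            ∏ i, ((sch.c r.curvature k * sch.a k ^ 4 *
              (r.curvature.F (Literature.MathematicalPhysics.QuantumLattice.configShift (-↑(x i)) (Literature.MathematicalPhysics.QuantumLattice.torusLift (sch.side k) U)) - sch.m r.curvature k) : ℝ) : ℂ)
          ∂(wilsonMeasure r.ρ (sch.β k))) →
      (∀ k : ℕ, sch.m r.curvature k =
        ∫ U : GaugeConfig 4 (sch.side k) G, r.curvature.F (Literature.MathematicalPhysics.QuantumLattice.torusLift (sch.side k) U) ∂(wilsonMeasure r.ρ (sch.β k))) →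
      (∀ k : ℕ, sch.c r.curvature k = (sch.a k ^ 4)⁻¹) →
      (∃ (s : ℕ) (α β' : ℝ), ∀ᶠ k in atTop, ∀ (p : ℕ) (q : Fin p → {q : Fin 4 × Fin 4 // q.1 < q.2})
        (F : SchwartzMap (Fin p → EuclideanSpace ℝ (Fin 4)) ℂ), IsOffDiagonal F →
        ‖∫ U : GaugeConfig 4 (sch.side k) G, ∑ x : Fin p → ↥(Literature.Probability.LatticeModels.box 4 (sch.L k)),
            F (fun i => sch.a k • siteToE ↑(x i)) *
              ∏ i, ((plaquetteObs r.ρ 0 (q i).1.1 (q i).1.2 (Literature.MathematicalPhysics.QuantumLattice.configShift (-↑(x i)) (Literature.MathematicalPhysics.QuantumLattice.torusLift (sch.side k) U)) -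
                wilsonTorusMean r.ρ (sch.β k) (sch.L k) (plaquetteObs r.ρ 0 (q i).1.1 (q i).1.2) : ℝ) : ℂ)
            ∂(wilsonMeasure r.ρ (sch.β k))‖ ≤ α * (p.factorial : ℝ) ^ β' * schwartzNorm (p * s) F) ∧
      (∃ (f g : SchwartzMap (Fin 1 → EuclideanSpace ℝ (Fin 4)) ℂ)
        (H : SchwartzMap (Fin (1 + 1) → EuclideanSpace ℝ (Fin 4)) ℂ),
        IsTimeOrdered f ∧ IsTimeOrdered g ∧ IsAppendTensorOf H (osAdjoint f) g ∧
          ∃ δ : ℝ, 0 < δ ∧ ∀ᶠ k in atTop, δ ≤ ‖LS k (1 + 1) H‖) ∧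
      (∀ R : EuclideanSpace ℝ (Fin 4) ≃ₗᵢ[ℝ] EuclideanSpace ℝ (Fin 4),
        R (EuclideanSpace.single 0 1) =
          (3 / 5 : ℝ) • EuclideanSpace.single 0 1 + (-(4 / 5) : ℝ) • EuclideanSpace.single 1 1 →
        R (EuclideanSpace.single 1 1) =
          (4 / 5 : ℝ) • EuclideanSpace.single 0 1 + (3 / 5 : ℝ) • EuclideanSpace.single 1 1 →
        R (EuclideanSpace.single 2 1) = EuclideanSpace.single 2 1 →
        R (EuclideanSpace.single 3 1) = EuclideanSpace.single 3 1 →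
        ∀ (n : ℕ) (F : SchwartzMap (Fin n → EuclideanSpace ℝ (Fin 4)) ℂ), IsOffDiagonal F →
          Tendsto (fun k : ℕ => LS k n (linActMulti R F) - LS k n F) atTop (𝓝 0)) := by
  intro G _ _ _ _ _ _ hG
  obtain ⟨r, hr⟩ := hFR G hG
  refine ⟨r, ?_⟩
  intro β mh S₁ K hβ hmh hK hU hS hcrit
  obtain ⟨a, φ, Δ₀, Λ₀, ha, hφ, hΔ₀, hpin, hS₁, ⟨N, hN1, hpoly⟩, hIR⟩ :=
    hr β mh S₁ K hβ hmh hK hU hS hcrit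
  obtain ⟨Λ, C, p, s, k₀, hΛ, hC, hCBΛ⟩ :=
    hCB G hG r β mh S₁ hβ hmh hU a φ Δ₀ Λ₀ ha hφ hΔ₀ hpin hS₁
  refine ⟨a, φ, Δ₀, fun k => {L | Λ k ≤ L ∧ IsTriadic L}, ha, hφ, hΔ₀, hpin, ?_, ?_, ?_, ?_⟩
  · -- cofinal
    intro k S
    obtain ⟨L, hL, hT⟩ := arrays_exists_triadic_ge (max S (Λ k))
    exact ⟨L, ⟨(le_max_right _ _).trans hL, hT⟩, (le_max_left _ _).trans hL⟩
  · -- inside the clustering regime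
    intro k S hSk
    exact (hS₁ k).trans ((hΛ k).trans hSk.1)
  · -- polynomial volume growth (inherited from the tail `L ≥ Λ₀ k`)
    exact ⟨N, hN1, hpoly.mono fun k hk S hSk => hk S ((hΛ k).trans hSk.1)⟩
  intro sch hsa hsβ hsL LS hLS hm hc
  have hL₀ : ∀ k, Λ₀ k ≤ sch.L k := fun k => (hΛ k).trans (hsL k).1
  obtain ⟨hND, hROT⟩ := hIR sch hsa hsβ hL₀ LS hLS hm hc
  refine ⟨?_, hND, hROT⟩
  -- (UUVB) from (CHESS), (CB) and the Whitney step
  have hPVG : PolyVolumeGrowth sch := by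
    refine ⟨N, hN1, hpoly.mono fun k hk => ?_⟩
    rw [hsa]
    exact hk (sch.L k) (hL₀ k)
  have hPB : ProductBound r sch :=
    arrays_productBound_of_exponent r sch hsa hsβ (fun k => hsL k) hβ hφ hC hCBΛ
  have hUU : UUVB r sch := hPTU G r sch hPVG hPB
  obtain ⟨s', α, β', h⟩ := hUU
  exact ⟨s', α, β', h⟩

include hFR hCB hPTU hSW in
/-- **`ContinuumLegGivenGap_of_arrays`** — the line's reduction: the crux for route `ComplexCouplingChannel`, BY NAME, from
criticality `XiDiverges` (stmt-QuantumFields-8941, by name), the socket (FR), the bet (CB), the Whitney step (PTU), the socket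
(SW), and the landed split `ContinuumLegGivenGap_of_subs_all`. [folklore] -/
theorem ContinuumLegGivenGap_of_arrays (hXi : DirichletWindow.XiDiverges) : ComplexCouplingChannel.ContinuumLegGivenGap :=
  (Summit.QuantumFields.YangMills.Theorems.ContinuumLegGivenGap.ContinuumLegGivenGap_of_subs_all hXi
    (arrays_uvEngine hFR hCB hPTU) hSW).1

include hFR hCB hPTU hSW in
/-- Twin: route `ConvexGribovBody`. [folklore] -/
theorem ConvexGribovBody_ContinuumLegGivenGap_of_arrays (hXi : DirichletWindow.XiDiverges) :
    ConvexGribovBody.ContinuumLegGivenGap :=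
  (Summit.QuantumFields.YangMills.Theorems.ContinuumLegGivenGap.ContinuumLegGivenGap_of_subs_all hXi
    (arrays_uvEngine hFR hCB hPTU) hSW).2.1

include hFR hCB hPTU hSW in
/-- Twin: route `SmallCircleAnchor`. [folklore] -/
theorem SmallCircleAnchor_ContinuumLegGivenGap_of_arrays (hXi : DirichletWindow.XiDiverges) :
    SmallCircleAnchor.ContinuumLegGivenGap :=
  (Summit.QuantumFields.YangMills.Theorems.ContinuumLegGivenGap.ContinuumLegGivenGap_of_subs_all hXi
    (arrays_uvEngine hFR hCB hPTU) hSW).2.2.1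

include hFR hCB hPTU hSW in
/-- Twin: route `HyperbolicRegulator`. [folklore] -/
theorem HyperbolicRegulator_ContinuumLegGivenGap_of_arrays (hXi : DirichletWindow.XiDiverges) :
    HyperbolicRegulator.ContinuumLegGivenGap :=
  (Summit.QuantumFields.YangMills.Theorems.ContinuumLegGivenGap.ContinuumLegGivenGap_of_subs_all hXi
    (arrays_uvEngine hFR hCB hPTU) hSW).2.2.2.1

include hFR hCB hPTU hSW in
/-- Twin: route `ContractibleFibre` (`WeakCouplingContinuumLeg`). [folklore] -/
theorem ContractibleFibre_WeakCouplingContinuumLeg_of_arrays (hXi : DirichletWindow.XiDiverges) :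
    ContractibleFibre.WeakCouplingContinuumLeg :=
  (Summit.QuantumFields.YangMills.Theorems.ContinuumLegGivenGap.ContinuumLegGivenGap_of_subs_all hXi
    (arrays_uvEngine hFR hCB hPTU) hSW).2.2.2.2.1

include hFR hCB hPTU hSW in
/-- Twin: route `DoublingDefect`. [folklore] -/
theorem DoublingDefect_ContinuumLegGivenGap_of_arrays (hXi : DirichletWindow.XiDiverges) :
    DoublingDefect.ContinuumLegGivenGap :=
  (Summit.QuantumFields.YangMills.Theorems.ContinuumLegGivenGap.ContinuumLegGivenGap_of_subs_all hXi
    (arrays_uvEngine hFR hCB hPTU) hSW).2.2.2.2.2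

include hFR hCB hPTU hSW in
/-- Twin: route `NoiseSynchronisation` (character-identical seventh declaration of the shared item). [folklore] -/
theorem NoiseSynchronisation_ContinuumLegGivenGap_of_arrays (hXi : DirichletWindow.XiDiverges) :
    NoiseSynchronisation.ContinuumLegGivenGap :=
  ConvexGribovBody_ContinuumLegGivenGap_of_arrays hFR hCB hPTU hSW hXi

end Reduction

end Summit.QuantumFields.YangMills.Theorems.ContinuumLegGivenGap

end
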